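import Mathlib
import Literature.Computability.Complexity.LowDegreeExtension
import HarnessLib

/-!
# Arithmetic on base-`h` digit vectors by low-degree polynomials: equality, comparison, successor

Literature / complexity toolkit, a brick of the algebraic engine of probabilistically checkable
proofs for exponential-time computations. In the arithmetization of a computation tableau
(Babai–Fortnow–Lund 1991, §4; Babai–Fortnow–Levin–Szegedy 1991, §4; Arora–Barak 2009, §8.6 /
§11.5.2) the row and column numbers of the tableau are written in base `h` with `k` digits, each
digit being a coordinate ranging over the node set `H = {0, 1, …, h - 1} ⊆ F`; the constraints
"cell `(t+1, J)` follows from the window of row `t`", "column `J < width`", "cell `(0, J)` holds the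
input bit `x_J`" then need the predicates `[u' = u + 1]`, `[u < c]`, `[u = c]`, `[u = u']` on digit
vectors as POLYNOMIALS of low degree in the digit coordinates which the verifier can evaluate at
arbitrary field points. This file supplies them, over an arbitrary ambient variable type `σ` with
the digits placed at `U : Fin k → σ` (so that no renaming is needed in the recursion on `k`):

* `eqC h e v` (`[X_v = e]`, a Lagrange basis polynomial of `H` placed in the variable `v`),
  `eqV` (`[X_v = X_{v'}]`), `ltD` (`[X_v < c]`);
* `EQC h k c U` (`[val u = c]`), `LTC h k c U` (`[val u < c]`), `EQV h k U U'` (`[u = u']`),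
  **`SUCC h k U U'`** (`[val u' = val u + 1]`), all by recursion on the number of digits
  (`val u = u₀ + h · val (tail u)`: `val u' = val u + 1 ↔ (u'₀ = u₀ + 1 < h ∧ tails equal) ∨
  (u₀ = h - 1 ∧ u'₀ = 0 ∧ val tail' = val tail + 1)`);
* their VALUES on digit points (`eval_EQC`, `eval_LTC`, `eval_EQV`, `eval_SUCC`: the Boolean
  indicator of the predicate, as `0`/`1` in `F`) and total-degree bounds (`totalDegree_*_le`);
* `dval` (the number with given digits), `dval_lt`, `digitsOf` and `dval_digitsOf` (every number
  `< hᵏ` has a digit vector), `dval_injective`.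

Hypotheses: `h ≤ ringChar`-type injectivity of `ℕ → F` below `h` is passed as
`hinj : ∀ a b, a < h → b < h → (a : F) = b → a = b`.

## References

* L. Babai, L. Fortnow, C. Lund, *Non-deterministic exponential time has two-prover interactive
  protocols*, Comput. Complexity 1 (1991), §4 (arithmetization of the tableau) [BabaiFortnowLund1991].
* L. Babai, L. Fortnow, L. Levin, M. Szegedy, *Checking computations in polylogarithmic time*,
  STOC 1991, §4 [BFLS1991].
* S. Arora, B. Barak, *Computational Complexity: A Modern Approach*, CUP 2009, §8.6, §11.5.2
  [AroraBarakCC2009].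
-/

noncomputable section

open Finset Polynomial

namespace Literature.Computability.Complexity

namespace DigitPoly

variable {F : Type*} [Field F] [DecidableEq F] {σ : Type*}

/-! ### The node set `{0, …, h-1}` and numbers from digits -/

/-- The node set `H = {0, 1, …, h - 1} ⊆ F`. [cite: BFLS1991, §4] -/
def nodes (h : ℕ) : Finset F := (range h).image (Nat.cast : ℕ → F)

/-- A small natural number is a node. [folklore] -/
theorem cast_mem_nodes {h a : ℕ} (ha : a < h) : (a : F) ∈ nodes (F := F) h :=
  mem_image.2 ⟨a, mem_range.2 ha, rfl⟩

/-- The number with digits `n₀, …, n_{k-1}` in base `h` (least significant first). [folklore] -/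
def dval (h : ℕ) {k : ℕ} (n : Fin k → ℕ) : ℕ := ∑ i, n i * h ^ (i : ℕ)

/-- Peeling the lowest digit: `val n = n₀ + h · val (tail n)`. [folklore] -/
theorem dval_succ (h : ℕ) {k : ℕ} (n : Fin (k + 1) → ℕ) : dval h n = n 0 + h * dval h (fun i => n i.succ) := by
  unfold dval
  rw [Fin.sum_univ_succ, Fin.val_zero, pow_zero, mul_one, mul_sum]
  congr 1
  refine sum_congr rfl fun i _ => ?_
  rw [Fin.val_succ, pow_succ]
  ring

/-- `val n = 0` for zero digits. [folklore] -/
@[simp] theorem dval_zero (h : ℕ) (n : Fin 0 → ℕ) : dval h n = 0 := by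
  simp [dval]

/-- A digit vector represents a number `< hᵏ`. [folklore] -/
theorem dval_lt (h : ℕ) : ∀ {k : ℕ} (n : Fin k → ℕ), (∀ i, n i < h) → dval h n < h ^ k
  | 0, n, _ => by simp
  | k + 1, n, hn => by
    rw [dval_succ, pow_succ]
    have ih := dval_lt h (fun i => n i.succ) fun i => hn i.succ
    have h0 := hn 0
    calc n 0 + h * dval h (fun i => n i.succ) < h + h * dval h (fun i => n i.succ) := Nat.add_lt_add_right h0 _
      _ = h * (dval h (fun i => n i.succ) + 1) := by ring
      _ ≤ h * h ^ k := Nat.mul_le_mul_left h ih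
      _ = h ^ k * h := mul_comm _ _

/-- The digits of a number. [folklore] -/
def digitsOf (h : ℕ) {k : ℕ} (N : ℕ) : Fin k → ℕ := fun i => N / h ^ (i : ℕ) % h

/-- Digits are `< h` (for `0 < h`). [folklore] -/
theorem digitsOf_lt {h : ℕ} (hh : 0 < h) {k : ℕ} (N : ℕ) (i : Fin k) : digitsOf h N i < h :=
  Nat.mod_lt _ hh

/-- A number `< hᵏ` is the value of its digits. [folklore] -/
theorem dval_digitsOf {h : ℕ} (hh : 0 < h) : ∀ {k : ℕ} {N : ℕ}, N < h ^ k → dval h (digitsOf h (k := k) N) = N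
  | 0, N, hN => by simp at hN; simp [hN]
  | k + 1, N, hN => by
    rw [dval_succ]
    have htail : (fun i : Fin k => digitsOf h (k := k + 1) N i.succ) = digitsOf h (k := k) (N / h) := by
      funext i
      simp only [digitsOf, Fin.val_succ, pow_succ]
      rw [Nat.div_div_eq_div_mul, mul_comm]
    rw [htail, dval_digitsOf hh (k := k) (N := N / h) ?_]
    · simp only [digitsOf, Fin.val_zero, pow_zero, Nat.div_one]
      exact Nat.mod_add_div N h
    · rw [pow_succ] at hN
      exact Nat.div_lt_of_lt_mul (by rwa [mul_comm] at hN)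

/-- Digit vectors represent numbers injectively. [folklore] -/
theorem dval_injective (h : ℕ) : ∀ {k : ℕ} {n n' : Fin k → ℕ}, (∀ i, n i < h) → (∀ i, n' i < h) →
    dval h n = dval h n' → n = n'
  | 0, n, n', _, _, _ => funext fun i => i.elim0
  | k + 1, n, n', hn, hn', heq => by
    rw [dval_succ, dval_succ] at heq
    have h0 : n 0 = n' 0 := by
      have := congrArg (· % h) heq
      simp only [Nat.add_mul_mod_self_left, Nat.mod_eq_of_lt (hn 0), Nat.mod_eq_of_lt (hn' 0)] at this
      exact this
    have hpos : 0 < h := lt_of_le_of_lt (Nat.zero_le _) (hn 0)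
    have htl : dval h (fun i => n i.succ) = dval h (fun i => n' i.succ) := by
      rw [h0] at heq
      exact Nat.eq_of_mul_eq_mul_left hpos (Nat.add_left_cancel heq)
    have ih := dval_injective h (fun i => hn i.succ) (fun i => hn' i.succ) htl
    funext i
    refine Fin.cases h0 (fun j => ?_) i
    exact congrFun ih j

/-! ### One digit: `[X = e]`, `[X = X']`, `[X < c]` -/

section OneDigit

variable (h : ℕ)

/-- `[X_v = e]`: the Lagrange basis polynomial of the node `e` of `H`, in the variable `v`
(zero polynomial for `e ≥ h`). [cite: BFLS1991, §4] -/
def eqC (e : ℕ) (v : σ) : MvPolynomial σ F :=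
  if e < h then (Lagrange.basis (nodes (F := F) h) id (e : F)).toMvPolynomial v else 0

/-- `[X_v = X_{v'}] = ∑_{e < h} [X_v = e] [X_{v'} = e]`. [cite: BFLS1991, §4] -/
def eqV (v v' : σ) : MvPolynomial σ F := ∑ e ∈ range h, eqC h e v * eqC h e v'

/-- `[X_v < c] = ∑_{e < min c h} [X_v = e]`. [folklore] -/
def ltD (c : ℕ) (v : σ) : MvPolynomial σ F := ∑ e ∈ range (min c h), eqC h e v

variable {h} (hinj : ∀ a b : ℕ, a < h → b < h → (a : F) = b → a = b)
include hinj

/-- Value of `[X_v = e]` at a digit point. [folklore] -/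
theorem eval_eqC {pt : σ → F} {v : σ} {a : ℕ} (ha : a < h) (hpt : pt v = a) (e : ℕ) :
    MvPolynomial.eval pt (eqC (F := F) h e v) = if a = e then 1 else 0 := by
  unfold eqC
  by_cases he : e < h
  · rw [if_pos he, MvPolynomial.eval_toMvPolynomial, hpt]
    by_cases hae : a = e
    · subst hae
      rw [if_pos rfl]
      exact Lagrange.eval_basis_self (v := id) (fun _ _ _ _ h => h) (cast_mem_nodes he)
    · rw [if_neg hae]
      exact Lagrange.eval_basis_of_ne (v := id) (fun heq => hae (hinj e a he ha heq).symm) (cast_mem_nodes ha)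
  · rw [if_neg he, map_zero]
    have hae : a ≠ e := fun hae => he (hae ▸ ha)
    rw [if_neg hae]

/-- Value of `[X_v = X_{v'}]` at a digit point. [folklore] -/
theorem eval_eqV {pt : σ → F} {v v' : σ} {a b : ℕ} (ha : a < h) (hb : b < h) (hv : pt v = a) (hv' : pt v' = b) :
    MvPolynomial.eval pt (eqV (F := F) h v v') = if a = b then 1 else 0 := by
  unfold eqV
  rw [map_sum]
  simp only [map_mul, eval_eqC hinj ha hv, eval_eqC hinj hb hv']
  split_ifs with hab
  · subst hab
    rw [sum_eq_single a]
    · simp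
    · intro e _ he
      simp [Ne.symm he]
    · intro hna
      exact absurd (mem_range.2 ha) hna
  · refine sum_eq_zero fun e _ => ?_
    by_cases hae : a = e
    · subst hae
      simp [Ne.symm hab]
    · simp [hae]

/-- Value of `[X_v < c]` at a digit point. [folklore] -/
theorem eval_ltD {pt : σ → F} {v : σ} {a : ℕ} (ha : a < h) (hv : pt v = a) (c : ℕ) :
    MvPolynomial.eval pt (ltD (F := F) h c v) = if a < c then 1 else 0 := by
  unfold ltD
  rw [map_sum]
  simp only [eval_eqC hinj ha hv]
  split_ifs with hac
  · rw [sum_eq_single a]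
    · simp
    · intro e _ he
      simp [Ne.symm he]
    · intro hna
      exact absurd (mem_range.2 (lt_min hac ha)) hna
  · refine sum_eq_zero fun e he => ?_
    have : e < c := (mem_range.1 he).trans_le (min_le_left _ _)
    simp [show a ≠ e from fun hae => hac (hae ▸ this)]

end OneDigit

/-! ### Digit vectors: `[val u = c]`, `[val u < c]`, `[u = u']`, `[val u' = val u + 1]` -/

section Vectors

variable (h : ℕ)

/-- `[val u = c]`, by recursion on the number of digits: `[u₀ = c mod h] · [val tail = c / h]`.
[cite: BFLS1991, §4] -/
def EQC : (k : ℕ) → (c : ℕ) → (U : Fin k → σ) → MvPolynomial σ F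
  | 0, c, _ => if c = 0 then 1 else 0
  | k + 1, c, U => eqC h (c % h) (U 0) * EQC k (c / h) fun i => U i.succ

/-- `[val u < c]`, by recursion: `[val tail < c / h] + [val tail = c / h] · [u₀ < c mod h]`. [folklore] -/
def LTC : (k : ℕ) → (c : ℕ) → (U : Fin k → σ) → MvPolynomial σ F
  | 0, c, _ => if 0 < c then 1 else 0
  | k + 1, c, U => LTC k (c / h) (fun i => U i.succ) + EQC h k (c / h) (fun i => U i.succ) * ltD h (c % h) (U 0)

/-- `[u = u']`, digit by digit. [folklore] -/
def EQV : (k : ℕ) → (U U' : Fin k → σ) → MvPolynomial σ F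
  | 0, _, _ => 1
  | k + 1, U, U' => eqV h (U 0) (U' 0) * EQV k (fun i => U i.succ) fun i => U' i.succ

/-- `[u'₀ = u₀ + 1]` (no carry): `∑_{e < h - 1} [u₀ = e] [u'₀ = e + 1]`. [folklore] -/
def succD (v v' : σ) : MvPolynomial σ F := ∑ e ∈ range (h - 1), eqC h e v * eqC h (e + 1) v'

/-- **`[val u' = val u + 1]`** — the successor predicate on base-`h` digit vectors as a polynomial,
by recursion on the number of digits: either the lowest digit increments without carry and the
tails agree, or the lowest digit wraps from `h - 1` to `0` and the tails are successive.
[cite: BabaiFortnowLund1991, §4] [cite: AroraBarakCC2009, §11.5.2] -/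
def SUCC : (k : ℕ) → (U U' : Fin k → σ) → MvPolynomial σ F
  | 0, _, _ => 0
  | k + 1, U, U' => succD h (U 0) (U' 0) * EQV h k (fun i => U i.succ) (fun i => U' i.succ) +
      eqC h (h - 1) (U 0) * eqC h 0 (U' 0) * SUCC k (fun i => U i.succ) fun i => U' i.succ

variable {h} (hinj : ∀ a b : ℕ, a < h → b < h → (a : F) = b → a = b)
include hinj

/-- Value of `[val u = c]` at a digit point. [folklore] -/
theorem eval_EQC : ∀ {k : ℕ} (c : ℕ) {U : Fin k → σ} {pt : σ → F} {n : Fin k → ℕ}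
    (_ : ∀ i, n i < h) (_ : ∀ i, pt (U i) = n i),
    MvPolynomial.eval pt (EQC (F := F) h k c U) = if dval h n = c then 1 else 0
  | 0, c, U, pt, n, hn, hpt => by
    simp only [EQC, dval_zero]
    rcases eq_or_ne c 0 with rfl | hc
    · simp
    · simp [hc, Ne.symm hc]
  | k + 1, c, U, pt, n, hn, hpt => by
    simp only [EQC, map_mul]
    rw [eval_eqC hinj (hn 0) (hpt 0), eval_EQC (c / h) (fun i => hn i.succ) (fun i => hpt i.succ), dval_succ]
    have hpos : 0 < h := lt_of_le_of_lt (Nat.zero_le _) (hn 0)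
    by_cases heq : n 0 + h * dval h (fun i : Fin k => n i.succ) = c
    · have h0 : n 0 = c % h := by
        rw [← heq, Nat.add_mul_mod_self_left, Nat.mod_eq_of_lt (hn 0)]
      have h1 : dval h (fun i : Fin k => n i.succ) = c / h := by
        rw [← heq, Nat.add_mul_div_left _ _ hpos, Nat.div_eq_of_lt (hn 0), zero_add]
      rw [if_pos h0, if_pos h1, if_pos heq, one_mul]
    · rw [if_neg heq]
      by_cases h0 : n 0 = c % h
      · have h1 : dval h (fun i : Fin k => n i.succ) ≠ c / h := by
          intro h1
          apply heq
          rw [h0, h1, Nat.mod_add_div]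
        rw [if_neg h1, mul_zero]
      · rw [if_neg h0, zero_mul]

/-- Value of `[val u < c]` at a digit point. [folklore] -/
theorem eval_LTC : ∀ {k : ℕ} (c : ℕ) {U : Fin k → σ} {pt : σ → F} {n : Fin k → ℕ}
    (_ : ∀ i, n i < h) (_ : ∀ i, pt (U i) = n i),
    MvPolynomial.eval pt (LTC (F := F) h k c U) = if dval h n < c then 1 else 0
  | 0, c, U, pt, n, hn, hpt => by
    simp only [LTC, dval_zero]
    split_ifs <;> simp
  | k + 1, c, U, pt, n, hn, hpt => by
    simp only [LTC, map_add, map_mul]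
    rw [eval_LTC (c / h) (fun i => hn i.succ) (fun i => hpt i.succ),
      eval_EQC hinj (c / h) (fun i => hn i.succ) (fun i => hpt i.succ), eval_ltD hinj (hn 0) (hpt 0), dval_succ]
    have hpos : 0 < h := lt_of_le_of_lt (Nat.zero_le _) (hn 0)
    set q := dval h (fun i : Fin k => n i.succ) with hq
    have hc := Nat.mod_add_div c h
    have hm := Nat.mod_lt c hpos
    have hn0 := hn 0
    -- `n₀ + h q < c ↔ q < c / h ∨ (q = c / h ∧ n₀ < c % h)`
    have key : (n 0 + h * q < c) ↔ (q < c / h ∨ (q = c / h ∧ n 0 < c % h)) := by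
      constructor
      · intro hlt
        by_cases hq' : q < c / h
        · exact Or.inl hq'
        · right
          have hge : c / h ≤ q := not_lt.1 hq'
          have hle : q ≤ c / h := by
            by_contra hgt
            have hgt' : c / h + 1 ≤ q := by omega
            have := Nat.mul_le_mul_left h hgt'
            linarith
          have hqe : q = c / h := le_antisymm hle hge
          refine ⟨hqe, ?_⟩
          rw [hqe] at hlt
          omega
      · rintro (hq' | ⟨hqe, hlt⟩)
        · have h1 : h * (q + 1) ≤ h * (c / h) := Nat.mul_le_mul_left h hq'
          have h2 : h * (c / h) ≤ c := Nat.mul_div_le c h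
          linarith
        · rw [hqe]
          omega
    by_cases hlt : n 0 + h * q < c
    · rw [if_pos hlt]
      rcases key.1 hlt with hA | ⟨hB, hC⟩
      · rw [if_pos hA, if_neg hA.ne]
        simp
      · have hA : ¬ q < c / h := by rw [hB]; exact lt_irrefl _
        rw [if_neg hA, if_pos hB, if_pos hC]
        simp
    · rw [if_neg hlt]
      have hA : ¬ q < c / h := fun hA => hlt (key.2 (Or.inl hA))
      rw [if_neg hA]
      by_cases hB : q = c / h
      · have hC : ¬ n 0 < c % h := fun hC => hlt (key.2 (Or.inr ⟨hB, hC⟩))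
        rw [if_pos hB, if_neg hC]
        simp
      · rw [if_neg hB]
        simp

/-- Value of `[u = u']` at digit points. [folklore] -/
theorem eval_EQV : ∀ {k : ℕ} {U U' : Fin k → σ} {pt : σ → F} {n n' : Fin k → ℕ}
    (_ : ∀ i, n i < h) (_ : ∀ i, n' i < h) (_ : ∀ i, pt (U i) = n i) (_ : ∀ i, pt (U' i) = n' i),
    MvPolynomial.eval pt (EQV (F := F) h k U U') = if n = n' then 1 else 0
  | 0, U, U', pt, n, n', _, _, _, _ => by
    simp only [EQV, map_one]
    rw [if_pos (_root_.funext fun i => Fin.elim0 i)]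
  | k + 1, U, U', pt, n, n', hn, hn', hpt, hpt' => by
    simp only [EQV, map_mul]
    rw [eval_eqV hinj (hn 0) (hn' 0) (hpt 0) (hpt' 0),
      eval_EQV (fun i => hn i.succ) (fun i => hn' i.succ) (fun i => hpt i.succ) (fun i => hpt' i.succ)]
    by_cases heq : n = n'
    · subst heq
      simp
    · rw [if_neg heq]
      by_cases h0 : n 0 = n' 0
      · have htl : (fun i : Fin k => n i.succ) ≠ fun i : Fin k => n' i.succ := by
          intro htl
          apply heq
          funext i
          refine Fin.cases h0 (fun j => congrFun htl j) i
        rw [if_neg htl, mul_zero]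
      · rw [if_neg h0, zero_mul]

/-- Value of `[u'₀ = u₀ + 1]` at digit points. [folklore] -/
theorem eval_succD {pt : σ → F} {v v' : σ} {a b : ℕ} (ha : a < h) (hb : b < h) (hv : pt v = a) (hv' : pt v' = b) :
    MvPolynomial.eval pt (succD (F := F) h v v') = if b = a + 1 then 1 else 0 := by
  unfold succD
  rw [map_sum]
  simp only [map_mul, eval_eqC hinj ha hv, eval_eqC hinj hb hv']
  by_cases hab : b = a + 1
  · rw [if_pos hab, sum_eq_single a]
    · simp [hab]
    · intro e _ he
      simp [Ne.symm he]
    · intro hna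
      exfalso
      exact hna (mem_range.2 (by omega))
  · rw [if_neg hab]
    refine sum_eq_zero fun e _ => ?_
    by_cases hae : a = e
    · subst hae
      simp [hab]
    · simp [hae]

omit [DecidableEq F] hinj in
/-- The arithmetic of the successor in base `h`: `a' + h q' = a + h q + 1` with digits
`a, a' < h` iff either `a' = a + 1` without carry and `q' = q`, or `a = h - 1`, `a' = 0` and
`q' = q + 1`. [folklore] -/
theorem succ_iff {h : ℕ} (hpos : 0 < h) {a a' q q' : ℕ} (ha : a < h) (ha' : a' < h) :
    a' + h * q' = a + h * q + 1 ↔ (a' = a + 1 ∧ q' = q) ∨ (a = h - 1 ∧ a' = 0 ∧ q' = q + 1) := by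
  constructor
  · intro heq
    by_cases hc : a + 1 < h
    · left
      have hmod : a' = a + 1 := by
        have h1 : (a' + h * q') % h = (a + h * q + 1) % h := congrArg (· % h) heq
        rw [Nat.add_mul_mod_self_left, Nat.mod_eq_of_lt ha', show a + h * q + 1 = (a + 1) + h * q by ring,
          Nat.add_mul_mod_self_left, Nat.mod_eq_of_lt hc] at h1
        exact h1
      refine ⟨hmod, ?_⟩
      rw [hmod] at heq
      have : h * q' = h * q := by omega
      exact Nat.eq_of_mul_eq_mul_left hpos this
    · right
      have hlast : a = h - 1 := by omega
      have e : a + h * q + 1 = 0 + h * (q + 1) := by rw [Nat.mul_succ]; omega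
      rw [e] at heq
      have hmod : a' = 0 := by
        have h1 : (a' + h * q') % h = (0 + h * (q + 1)) % h := congrArg (· % h) heq
        rw [Nat.add_mul_mod_self_left, Nat.mod_eq_of_lt ha', Nat.add_mul_mod_self_left, Nat.zero_mod] at h1
        exact h1
      refine ⟨hlast, hmod, ?_⟩
      rw [hmod] at heq
      exact Nat.eq_of_mul_eq_mul_left hpos (by simpa using heq)
  · rintro (⟨rfl, rfl⟩ | ⟨rfl, rfl, rfl⟩)
    · ring
    · rw [zero_add, Nat.mul_succ]
      omega

/-- **Value of the successor polynomial at digit points**: the indicator of `val u' = val u + 1`.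
[cite: BabaiFortnowLund1991, §4] -/
theorem eval_SUCC : ∀ {k : ℕ} {U U' : Fin k → σ} {pt : σ → F} {n n' : Fin k → ℕ}
    (_ : ∀ i, n i < h) (_ : ∀ i, n' i < h) (_ : ∀ i, pt (U i) = n i) (_ : ∀ i, pt (U' i) = n' i),
    MvPolynomial.eval pt (SUCC (F := F) h k U U') = if dval h n' = dval h n + 1 then 1 else 0
  | 0, U, U', pt, n, n', _, _, _, _ => by simp [SUCC]
  | k + 1, U, U', pt, n, n', hn, hn', hpt, hpt' => by
    simp only [SUCC, map_add, map_mul]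
    rw [eval_succD hinj (hn 0) (hn' 0) (hpt 0) (hpt' 0),
      eval_EQV hinj (fun i => hn i.succ) (fun i => hn' i.succ) (fun i => hpt i.succ) (fun i => hpt' i.succ),
      eval_eqC hinj (hn 0) (hpt 0), eval_eqC hinj (hn' 0) (hpt' 0),
      eval_SUCC (fun i => hn i.succ) (fun i => hn' i.succ) (fun i => hpt i.succ) (fun i => hpt' i.succ),
      dval_succ, dval_succ]
    set q := dval h (fun i : Fin k => n i.succ) with hq
    set q' := dval h (fun i : Fin k => n' i.succ) with hq'
    have hn0 := hn 0
    have hn0' := hn' 0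
    have hpos : 0 < h := lt_of_le_of_lt (Nat.zero_le _) hn0
    -- tails equal iff their values are equal
    have htl : ((fun i : Fin k => n i.succ) = fun i : Fin k => n' i.succ) ↔ q' = q := by
      constructor
      · intro e
        rw [hq, hq', e]
      · intro e
        exact (dval_injective h (fun i => hn' i.succ) (fun i => hn i.succ) (by rw [← hq, ← hq']; exact e)).symm
    have key := succ_iff hpos (q := q) (q' := q') hn0 hn0'
    by_cases hP : n' 0 + h * q' = n 0 + h * q + 1
    · rw [if_pos hP]
      rcases key.1 hP with ⟨h1, h2⟩ | ⟨h1, h2, h3⟩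
      · have h3 : ¬ n' 0 = 0 ∨ ¬ n 0 = h - 1 := by
          by_contra hno
          push Not at hno
          omega
        rw [if_pos h1, if_pos (htl.2 h2)]
        rcases h3 with h3 | h3
        · rw [if_neg h3]; simp
        · rw [if_neg h3]; simp
      · have h4 : ¬ n' 0 = n 0 + 1 := by omega
        rw [if_neg h4, if_pos h1, if_pos h2, if_pos h3]
        simp
    · rw [if_neg hP]
      have hA : ¬ (n' 0 = n 0 + 1 ∧ q' = q) := fun hA => hP (key.2 (Or.inl hA))
      have hB : ¬ (n 0 = h - 1 ∧ n' 0 = 0 ∧ q' = q + 1) := fun hB => hP (key.2 (Or.inr hB))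
      have t1 : (if n' 0 = n 0 + 1 then (1 : F) else 0) * (if (fun i : Fin k => n i.succ) = fun i : Fin k => n' i.succ
          then 1 else 0) = 0 := by
        by_cases h1 : n' 0 = n 0 + 1
        · have h2 : ¬ ((fun i : Fin k => n i.succ) = fun i : Fin k => n' i.succ) := fun h2 => hA ⟨h1, htl.1 h2⟩
          rw [if_neg h2, mul_zero]
        · rw [if_neg h1, zero_mul]
      have t2 : (if n 0 = h - 1 then (1 : F) else 0) * (if n' 0 = 0 then 1 else 0) * (if q' = q + 1 then 1 else 0) = 0 := by
        by_cases h1 : n 0 = h - 1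
        · by_cases h2 : n' 0 = 0
          · have h3 : ¬ q' = q + 1 := fun h3 => hB ⟨h1, h2, h3⟩
            rw [if_neg h3, mul_zero]
          · rw [if_neg h2, mul_zero, zero_mul]
        · rw [if_neg h1, zero_mul, zero_mul]
      rw [t1, t2, add_zero]

end Vectors

/-! ### Degree bounds -/

section Degrees

variable (h : ℕ)

omit [DecidableEq F] in
/-- Total degree of a one-variable polynomial placed in a variable. [folklore] -/
theorem totalDegree_toMvPolynomial_le' (P : F[X]) (v : σ) : (P.toMvPolynomial v).totalDegree ≤ P.natDegree := by
  rw [Polynomial.toMvPolynomial, Polynomial.aeval_eq_sum_range]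
  refine (MvPolynomial.totalDegree_finsetSum _ _).trans (Finset.sup_le fun n hn => ?_)
  refine (MvPolynomial.totalDegree_smul_le _ _).trans ((MvPolynomial.totalDegree_X_pow _ _).le.trans ?_)
  exact Nat.lt_succ_iff.mp (Finset.mem_range.mp hn)

/-- `deg [X = e] ≤ h - 1` (the node set has at most `h` elements). [folklore] -/
theorem totalDegree_eqC_le (e : ℕ) (v : σ) : (eqC (F := F) h e v).totalDegree ≤ h - 1 := by
  unfold eqC
  split_ifs with he
  · refine (totalDegree_toMvPolynomial_le' _ _).trans ?_
    rw [Lagrange.natDegree_basis (v := id) (fun _ _ _ _ h => h) (cast_mem_nodes he)]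
    have : (nodes (F := F) h).card ≤ h := card_image_le.trans (card_range h).le
    omega
  · simp

/-- `deg [X = X'] ≤ 2 (h - 1)`. [folklore] -/
theorem totalDegree_eqV_le (v v' : σ) : (eqV (F := F) h v v').totalDegree ≤ 2 * (h - 1) := by
  unfold eqV
  refine (MvPolynomial.totalDegree_finsetSum _ _).trans (Finset.sup_le fun e _ => ?_)
  refine (MvPolynomial.totalDegree_mul _ _).trans ?_
  have h1 := totalDegree_eqC_le (F := F) h e v
  have h2 := totalDegree_eqC_le (F := F) h e v'
  omega

/-- `deg [X < c] ≤ h - 1`. [folklore] -/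
theorem totalDegree_ltD_le (c : ℕ) (v : σ) : (ltD (F := F) h c v).totalDegree ≤ h - 1 := by
  unfold ltD
  exact (MvPolynomial.totalDegree_finsetSum _ _).trans (Finset.sup_le fun e _ => totalDegree_eqC_le h e v)

/-- `deg [u'₀ = u₀ + 1] ≤ 2 (h - 1)`. [folklore] -/
theorem totalDegree_succD_le (v v' : σ) : (succD (F := F) h v v').totalDegree ≤ 2 * (h - 1) := by
  unfold succD
  refine (MvPolynomial.totalDegree_finsetSum _ _).trans (Finset.sup_le fun e _ => ?_)
  refine (MvPolynomial.totalDegree_mul _ _).trans ?_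
  have h1 := totalDegree_eqC_le (F := F) h e v
  have h2 := totalDegree_eqC_le (F := F) h (e + 1) v'
  omega

/-- `deg [val u = c] ≤ k (h - 1)`. [folklore] -/
theorem totalDegree_EQC_le : ∀ (k c : ℕ) (U : Fin k → σ), (EQC (F := F) h k c U).totalDegree ≤ k * (h - 1)
  | 0, c, U => by simp only [EQC]; split_ifs <;> simp
  | k + 1, c, U => by
    simp only [EQC]
    refine (MvPolynomial.totalDegree_mul _ _).trans ?_
    have h1 := totalDegree_eqC_le (F := F) h (c % h) (U 0)
    have h2 := totalDegree_EQC_le k (c / h) (fun i => U i.succ)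
    rw [Nat.succ_mul]
    omega

/-- `deg [val u < c] ≤ k (h - 1)`. [folklore] -/
theorem totalDegree_LTC_le : ∀ (k c : ℕ) (U : Fin k → σ), (LTC (F := F) h k c U).totalDegree ≤ k * (h - 1)
  | 0, c, U => by simp only [LTC]; split_ifs <;> simp
  | k + 1, c, U => by
    simp only [LTC]
    refine (MvPolynomial.totalDegree_add _ _).trans (max_le ?_ ?_)
    · exact (totalDegree_LTC_le k (c / h) _).trans (by rw [Nat.succ_mul]; omega)
    · refine (MvPolynomial.totalDegree_mul _ _).trans ?_
      have h1 := totalDegree_EQC_le (F := F) h k (c / h) (fun i => U i.succ)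
      have h2 := totalDegree_ltD_le (F := F) h (c % h) (U 0)
      rw [Nat.succ_mul]
      omega

/-- `deg [u = u'] ≤ 2 k (h - 1)`. [folklore] -/
theorem totalDegree_EQV_le : ∀ (k : ℕ) (U U' : Fin k → σ), (EQV (F := F) h k U U').totalDegree ≤ 2 * k * (h - 1)
  | 0, U, U' => by simp [EQV]
  | k + 1, U, U' => by
    simp only [EQV]
    refine (MvPolynomial.totalDegree_mul _ _).trans ?_
    have h1 := totalDegree_eqV_le (F := F) h (U 0) (U' 0)
    have h2 := totalDegree_EQV_le k (fun i => U i.succ) (fun i => U' i.succ)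
    nlinarith

/-- `deg [val u' = val u + 1] ≤ 2 k (h - 1)`. [folklore] -/
theorem totalDegree_SUCC_le : ∀ (k : ℕ) (U U' : Fin k → σ), (SUCC (F := F) h k U U').totalDegree ≤ 2 * k * (h - 1)
  | 0, U, U' => by simp [SUCC]
  | k + 1, U, U' => by
    simp only [SUCC]
    refine (MvPolynomial.totalDegree_add _ _).trans (max_le ?_ ?_)
    · refine (MvPolynomial.totalDegree_mul _ _).trans ?_
      have h1 := totalDegree_succD_le (F := F) h (U 0) (U' 0)
      have h2 := totalDegree_EQV_le (F := F) h k (fun i => U i.succ) (fun i => U' i.succ)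
      nlinarith
    · refine (MvPolynomial.totalDegree_mul _ _).trans ?_
      have h12 : (eqC (F := F) h (h - 1) (U 0) * eqC h 0 (U' 0)).totalDegree ≤ (h - 1) + (h - 1) :=
        (MvPolynomial.totalDegree_mul _ _).trans
          (Nat.add_le_add (totalDegree_eqC_le (F := F) h (h - 1) (U 0)) (totalDegree_eqC_le (F := F) h 0 (U' 0)))
      have h3 := totalDegree_SUCC_le k (fun i => U i.succ) (fun i => U' i.succ)
      nlinarith

end Degrees

end DigitPoly

end Literature.Computability.Complexity

end
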